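import Literature.NumberTheory.EllipticCurves.Kriz2020.RankOnePConverse
import Literature.NumberTheory.EllipticCurves.Kriz2020.CongruentNumberDensityOneProofs
import Literature.NumberTheory.EllipticCurves.BSDSelmerSmithDecomposition
import Literature.NumberTheory.EllipticCurves.BSDSelmerCMPConverseGoldfeldProofs
import Literature.NumberTheory.EllipticCurves.BSDSelmerSmithGoldfeldProofs
import Literature.NumberTheory.EllipticCurves.LeadingTerm
import HarnessLib

/-!
# Kříž 2020, Theorem 10.17 (1) as a CONDITIONAL theorem: Goldfeld's conjecture, and the BSD rank formula with finite `Ш` for `100 %` of the quadratic twists, for every elliptic curve over `ℚ` with `j = 1728` satisfying Smith's Assumption 1.1 — modulo ONE named hypothesis, Kříž's rank-one `2`-converse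

Companion of `Kriz2020/RankOnePConverse.lean` (the named hypotheses) and
`Kriz2020/CongruentNumberDensityOneProofs.lean` (the congruent number family `y² = x³ − x`).
Theorems only: no definition, no named fact, no instance. Cell `bsd-cn100`
(`run/shared/lean/pub/bsd-cn100/`).

## The source statement (verbatim, v5 = arXiv:2002.04767v5, SP_v5.tex l. 11009, `\label{congruentnumberthm}`)

> **Theorem 10.17.** Suppose `E/ℚ` is an elliptic curve with `E(ℚ)[2] ≅ (ℤ/2)^{⊕2}` and no cyclic
> 4-isogeny defined over `ℚ`. Suppose further that `E` has CM by `K = ℚ(i)` or `ℚ(√−2)`. Then: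
> (1) Goldfeld's conjecture (Conjecture 10.16) is true for `E`, and `#Ш(E^d) < ∞` for 100% of
> squarefree `d`.

with Conjecture 10.16 (l. 11003): "For `r = 0, 1`,
`lim_{X → ∞} #{0 < |d| < X : d squarefree, r_an(E^d/ℚ) = r} / #{0 < |d| < X : d squarefree} = 1/2`"
— literally the tree's `twistDensity (fun d ↦ d ≠ 0 ∧ (E.quadraticTwist d).analyticRank = r) (1/2)`
(squarefree `d` of both signs ordered by `|d|`, `BSDSelmer.lean`) — and with proof (l. 11024):
"The 2-descent result [Smith, Thm. 1.2] implies that for `r = 0` or `1`, `r_2(E^d/ℚ) = r` for `50%`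
of squarefree `d`. By assumption, each `E^d` has CM by `𝒪_K`. Now applying Theorem 9.23 [rank `0`]
and Theorem 10.13 [rank `1`] for `p = 2` to each `E^d` with `r_2(E^d/ℚ) = r`, we arrive at
Goldfeld's conjecture for `E` as well as the finiteness of `#Ш(E^d)` for 100% of squarefree `d`."

## Transcription and scope

* "`E(ℚ)[2] ≅ (ℤ/2)²` and no cyclic `4`-isogeny over `ℚ`" is branch (3) of A. Smith's Assumption 1.1
  (J. Amer. Math. Soc. 39 (2026) = arXiv:2207.05674; tree `smi22aAssumption`, third disjunct:
  `ratTwoTorsionCard W = 4 ∧ ∀ ψ cyclic, deg ψ ≠ 4`). The theorems below are stated under the WHOLE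
  Assumption 1.1 (`hA : smi22aAssumption W`), which is what Smith's REFEREED Thm. 1.2
  (`h22 : smith2022_selmerCorank_distribution`) consumes; the printed branch-(3) form is the
  corollary `kriz_thm_10_17_1_of_converse_of_smith2022`. (So, beyond the printed hypothesis, the
  `j = 1728` curves `y² = x³ + Ax` with `A` and `−A` both non-squares in `ℚ` — one rational
  `2`-torsion point; branch (2), since `ℚ(A₀[2]) = ℚ(√A) ≠ ℚ, ℚ(√−A)` for `A₀ : y² = x³ − 4Ax`, a
  routine check not formalised here — are covered as well whenever `hA` is supplied; this is the
  same deduction, not a claim of the source.)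
* "CM by `K = ℚ(i)`" together with `E(ℚ)[2] ≅ (ℤ/2)²` means `j(E) = 1728` (CM by `ℤ[i]`; the other
  order of `ℚ(i)` with rational `j`, `ℤ[2i]`, `j = 287496`, has curves `y² = x³ − 11x ± 14` and
  their twists, each with a single rational point of order `2` — a routine check not formalised
  here); we take `hj : W.j = 1728` as the hypothesis, which is exactly what Thm. 10.13 at `p = 2`,
  `K = ℚ(i)` needs (`2 ∣ d_K = −4`, `Rank1Residual.CMRamified W 2`). The branch "`K = ℚ(√−2)`"
  of the printed statement is VACUOUS: a curve over `ℚ` with CM by `ℤ[√−2]` has `j = 8000` and is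
  a quadratic twist of `y² = x³ + 4x² + 2x = x(x² + 4x + 2)`, whose `2`-torsion field is `ℚ(√2)`
  — never `E(ℚ)[2] ≅ (ℤ/2)²` — and it also misses branch (2) of Assumption 1.1 (the `2`-isogenous
  `A₀ : y² = x³ − 8x² + 8x` has `ℚ(A₀[2]) = ℚ(√2) = ℚ(A[2])`); routine checks, not formalised;
  nothing is stated for that branch.
* `r_2 = corank_{ℤ_2} Sel_{2^∞}` is `selmerCorank 2 = selmerCorankTwoInfty` (`selmerCorankTwoInfty_eq`);
  `r_an` is `analyticRank`; "`#Ш(E^d) < ∞`" is `Finite (E^d).sha` (`Sha.lean`); the BSD rank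
  formula is `WeierstrassCurve.BSDRankFormula : r_an = r_MW` (`BSDInvariants.lean`).
* Hypotheses, by name. `hKg : kriz_analyticRank_eq_one_of_selmerCorank_eq_one_of_cmRamified` —
  Kříž's Thm. 10.13, the ONE UNREFEREED input (see `Kriz2020/RankOnePConverse.lean` for its status:
  preprint, two independent unrefereed claimed proofs, stated as open in print 2022–2026); used
  only at `p = 2`, `j = 1728`. `hBT : burungaleTian_analyticRank_eq_zero_of_selmerCorank_eq_zero_of_hasCM`
  — Burungale–Tian, Ann. of Math. 203 (2026), Thm. 1.1 (refereed; this is the tree's form of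
  Kříž's rank-zero Thm. 9.23, which is therefore NOT taken from the preprint).
  `hGZK : rank_eq_analyticRank_of_analyticRank_le_one` — Gross–Zagier–Kolyvagin (refereed).
  The Selmer input in two interchangeable forms: `hS : smith_selmerCorank_density W` (neutral: it
  is discharged either by A. Smith, arXiv:2503.17619, Thm. 1.1 — unrefereed — or, under
  `smi22aAssumption W`, by the refereed `h22`, `smith_selmerCorank_density_of_smith2022`), and
  the `…_of_smith2022` twins taking `h22 : smith2022_selmerCorank_distribution` +
  `hA : smi22aAssumption W` directly. On the `h22` route `hKg` is the only unrefereed binder.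

## Contents

1. The ENGINE, free of CM (the shape of the printed proof, and of Fan–Wan, arXiv:2304.09806v2,
   proof of Thm. 1.4, and of Smith, arXiv:2503.17619, Cor. 1.2): for an elliptic `W`, Smith's
   `1/2, 1/2, 0` distribution of `r_2` in the twist family + the rank-`0` and rank-`1`
   `2`-converses FOR THE TWISTS OF `W` give Goldfeld's conjecture for `W` in full (densities
   `1/2, 1/2` and `0` for every `r ≥ 2`; printed normalisation via `goldfeld_printed_iff_twistDensity`)
   and, with GZK, `r_an(E^d) = r_MW(E^d) ∧ #Ш(E^d) < ∞` for a density-one set of squarefree `d`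
   (`twistDensity_analyticRank_of_twoConverses`, `goldfeld_printed_of_twoConverses`,
   `twistDensity_bsdRankFormula_finite_sha_of_twoConverses`).
2. `j = 1728`: the converses for the twists from `hBT` (CM is twist-invariant,
   `hasCM_quadraticTwist_of_hasCM`) and `hKg` (`j(E^d) = j(E) = 1728`, `2 ∣ −4`); Thm. 10.17 (1)
   (`goldfeld_of_j_eq_1728_of_converse[_of_smith2022]`,
   `bsdRankFormula_finite_sha_densityOne_of_j_eq_1728_of_converse[_of_smith2022]`,
   `kriz_thm_10_17_1_of_converse_of_smith2022`).
3. Every congruent number curve `E_n : y² = x³ − n²x`, `n ≠ 0`, with THE cell hypothesis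
   `hK : rankOne_twoConverse_congruentNumber` instead of `hKg` (`E_n^{(d)} = E_{n|d|}` as models,
   `quadraticTwist_congruentNumberCurve`): Goldfeld for `E_n` in full and in print form, and the
   BSD rank formula with finite `Ш` for `100 %` of its twists (the sibling file treats `n = 1` and
   the counting forms "100 % of squarefree `n ≡ 5, 6, 7 (mod 8)` are congruent"; its
   `smith_selmerCorank_density_congruentNumberCurve_of_smith2022 h22 hn` discharges `hS` here on
   the refereed route — the `…_of_smith2022` twins at the end of §3 do exactly this, so that for
   EVERY `E_n` the Goldfeld and `100 %`-BSD statements stand on `hK` + refereed named facts only).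

## References

* [Kriz2020] D. Kříž, *Supersingular main conjectures, Sylvester's conjecture and Goldfeld's
  conjecture*, arXiv:2002.04767v5 (2022), Conj. 10.16, Thm. 10.17 (1) with its proof
  (SP_v5.tex l. 11003–11025), Thm. 10.13, Thm. 9.23. UNREFEREED (enters only as `hKg` / `hK`).
* [Smith2026SelmerTwistI] A. Smith, J. Amer. Math. Soc. 39 (2026), doi:10.1090/jams/1062,
  Thm. 1.2 with Assumption 1.1.
* [SmithGoldfeld2025] A. Smith, arXiv:2503.17619 (2025), Thm. 1.1, Cor. 1.2 (unrefereed; optional).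
* [BurungaleTian2026] A. Burungale, Y. Tian, Ann. of Math. 203 (2026), Thm. 1.1, Thm. 1.2, §3.2.1.
* [FanWan2023] H. Fan, X. Wan, arXiv:2304.09806v2 (2026), Thm. 1.4 and its proof (the same
  deduction "Smith + rank-0 converse + rank-1 converse ⇒ Goldfeld for CM curves"; unrefereed).
* [GrossZagierInvent1986] [KolyvaginEulerSystems1990] via `rank_eq_analyticRank_of_analyticRank_le_one` (bsd.S17).
-/

noncomputable section

open scoped Classical
open Filter Topology

open WeierstrassCurve

namespace Literature.NumberTheory.EllipticCurves

/-! ### 1. The engine: Smith's distribution and the two `2`-converses in a twist family -/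

section Engine

variable (W : WeierstrassCurve ℚ) [W.IsElliptic]

omit [W.IsElliptic] in
/-- **Goldfeld from the `2^∞`-Selmer distribution and the two `2`-converses in the family**
(the deduction of Kříž, v5, proof of Thm. 10.17; = Fan–Wan v2, proof of Thm. 1.4; = Smith,
arXiv:2503.17619, proof of Cor. 1.2 with the converses in place of BSD). Let `W/ℚ` be elliptic
with Smith's distribution `hS` (`r_2(E^d) = 0`, `= 1` with density `1/2` each). If for every
`d ≠ 0`, `r_2(E^d) = 0 ⟹ r_an(E^d) = 0` (`h0`) and `r_2(E^d) = 1 ⟹ r_an(E^d) = 1` (`h1`), then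
among squarefree `d` ordered by `|d|`: `r_an(E^d) = 0` with density `1/2`, `r_an(E^d) = 1` with
density `1/2`, and `r_an(E^d) = r` with density `0` for every `r ≥ 2`. Proof: on the density-one
set `{r_2(E^d) ≤ 1}` (`twistDensity_selmerCorankTwoInfty_le_one_of`) the conditions `r_2 = r` and
`r_an = r` (`r = 0, 1`) AGREE (`⟹` is the converse; `⟸` because the other corank would give the
other analytic rank), so they have the same density (`twistDensity_congr_of_one`); the sets
`{r_an = r}`, `r ≥ 2`, are disjoint from two disjoint sets of densities `1/2 + 1/2 = 1`
(`twistDensity_zero_of_disjoint`). [cite: Kriz2020, proof of Thm. 10.17 (v5, SP_v5.tex l. 11024)]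
[cite: SmithGoldfeld2025, Cor. 1.2 (proof)] -/
theorem twistDensity_analyticRank_of_twoConverses
    (h0 : ∀ d : ℤ, d ≠ 0 → (W.quadraticTwist d).selmerCorank 2 = 0 →
      (W.quadraticTwist d).analyticRank = 0)
    (h1 : ∀ d : ℤ, d ≠ 0 → (W.quadraticTwist d).selmerCorank 2 = 1 →
      (W.quadraticTwist d).analyticRank = 1)
    (hS : smith_selmerCorank_density W) :
    twistDensity (fun d ↦ d ≠ 0 ∧ (W.quadraticTwist d).analyticRank = 0) (1 / 2) ∧
      twistDensity (fun d ↦ d ≠ 0 ∧ (W.quadraticTwist d).analyticRank = 1) (1 / 2) ∧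
        ∀ r : ℕ, 2 ≤ r →
          twistDensity (fun d ↦ d ≠ 0 ∧ (W.quadraticTwist d).analyticRank = r) 0 := by
  have hR := twistDensity_selmerCorankTwoInfty_le_one_of W hS
  have key0 : ∀ d : ℤ, Squarefree d →
      (d ≠ 0 ∧ selmerCorankTwoInfty (W.quadraticTwist d) ≤ 1) →
        ((d ≠ 0 ∧ selmerCorankTwoInfty (W.quadraticTwist d) = 0) ↔
          (d ≠ 0 ∧ (W.quadraticTwist d).analyticRank = 0)) := by
    rintro d - ⟨hd, hle⟩
    rw [selmerCorankTwoInfty_eq] at hle ⊢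
    refine ⟨fun h ↦ ⟨hd, h0 d hd h.2⟩, fun h ↦ ⟨hd, ?_⟩⟩
    rcases Nat.le_one_iff_eq_zero_or_eq_one.mp hle with h0' | h1'
    · exact h0'
    · have := h1 d hd h1'
      rw [h.2] at this
      exact absurd this.symm one_ne_zero
  have key1 : ∀ d : ℤ, Squarefree d →
      (d ≠ 0 ∧ selmerCorankTwoInfty (W.quadraticTwist d) ≤ 1) →
        ((d ≠ 0 ∧ selmerCorankTwoInfty (W.quadraticTwist d) = 1) ↔
          (d ≠ 0 ∧ (W.quadraticTwist d).analyticRank = 1)) := by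
    rintro d - ⟨hd, hle⟩
    rw [selmerCorankTwoInfty_eq] at hle ⊢
    refine ⟨fun h ↦ ⟨hd, h1 d hd h.2⟩, fun h ↦ ⟨hd, ?_⟩⟩
    rcases Nat.le_one_iff_eq_zero_or_eq_one.mp hle with h0' | h1'
    · have := h0 d hd h0'
      rw [h.2] at this
      exact absurd this one_ne_zero
    · exact h1'
  have hA0 := (twistDensity_congr_of_one hR key0).1 hS.1
  have hA1 := (twistDensity_congr_of_one hR key1).1 hS.2.1
  refine ⟨hA0, hA1, fun r hr ↦ ?_⟩
  exact twistDensity_zero_of_disjoint hA0 hA1 (by norm_num)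
    (fun d _ h h' ↦ by have := h.2; rw [h'.2] at this; exact one_ne_zero this)
    (fun d _ h h' ↦ by have := h.2; rw [h'.2] at this; omega)
    (fun d _ h h' ↦ by have := h.2; rw [h'.2] at this; omega)

/-- **Goldfeld's conjecture for `W` in the printed normalisation** (Smith, arXiv:2503.17619, §1;
Goldfeld 1979): under the hypotheses of `twistDensity_analyticRank_of_twoConverses`, for every
`r ≥ 0`, `lim_{H → ∞} #{d ∈ ℤ, d ≠ 0, |d| ≤ H : r_an(E^d) = r} / 2H = 1/2` if `r ≤ 1` and `= 0`
if `r ≥ 2` (`goldfeld_printed_iff_twistDensity`). [cite: SmithGoldfeld2025, §1 (Goldfeld's Conjecture, display) and Cor. 1.2]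
[cite: Kriz2020, Conj. 10.16 and Thm. 10.17 (1) (v5)] -/
theorem goldfeld_printed_of_twoConverses
    (h0 : ∀ d : ℤ, d ≠ 0 → (W.quadraticTwist d).selmerCorank 2 = 0 →
      (W.quadraticTwist d).analyticRank = 0)
    (h1 : ∀ d : ℤ, d ≠ 0 → (W.quadraticTwist d).selmerCorank 2 = 1 →
      (W.quadraticTwist d).analyticRank = 1)
    (hS : smith_selmerCorank_density W) (r : ℕ) :
    Tendsto (fun H : ℕ ↦ (Nat.card {d : ℤ | d ≠ 0 ∧ |d| ≤ (H : ℤ) ∧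
        (W.quadraticTwist d).analyticRank = r} : ℝ) / (2 * H)) atTop
      (𝓝 (if r ≤ 1 then 1 / 2 else 0)) :=
  (goldfeld_printed_iff_twistDensity W).2 (twistDensity_analyticRank_of_twoConverses W h0 h1 hS) r

/-- **The BSD rank formula and `#Ш < ∞` for `100 %` of the twists, from the distribution, the two
converses and Gross–Zagier–Kolyvagin.** Under `h0`, `h1`, `hS` and `hGZK`
(`rank_eq_analyticRank_of_analyticRank_le_one`, bsd.S17): the squarefree `d` with
`ord_{s=1} L(E^d, s) = rank_ℤ E^d(ℚ)` and `Ш(E^d/ℚ)` finite have density `1` — they contain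
`{r_2(E^d) ≤ 1}` (density one, `twistDensity_selmerCorankTwoInfty_le_one_of`), on which
`r_an(E^d) = r_2(E^d) ≤ 1` by the converses and then GZK applies.
[cite: Kriz2020, Thm. 10.17 (1)-(2) (v5), "#Ш(E^d) < ∞ for 100% of squarefree d"]
[cite: KolyvaginEulerSystems1990] [cite: GrossZagierInvent1986] -/
theorem twistDensity_bsdRankFormula_finite_sha_of_twoConverses
    (h0 : ∀ d : ℤ, d ≠ 0 → (W.quadraticTwist d).selmerCorank 2 = 0 →
      (W.quadraticTwist d).analyticRank = 0)
    (h1 : ∀ d : ℤ, d ≠ 0 → (W.quadraticTwist d).selmerCorank 2 = 1 →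
      (W.quadraticTwist d).analyticRank = 1)
    (hGZK : rank_eq_analyticRank_of_analyticRank_le_one)
    (hS : smith_selmerCorank_density W) :
    twistDensity (fun d ↦ d ≠ 0 →
      (W.quadraticTwist d).BSDRankFormula ∧ Finite (W.quadraticTwist (d : ℚ)).sha) 1 := by
  refine twistDensity_one_mono (fun d _ hRd hd ↦ ?_)
    (twistDensity_selmerCorankTwoInfty_le_one_of W hS)
  obtain ⟨-, hle⟩ := hRd
  rw [selmerCorankTwoInfty_eq] at hle
  haveI := W.isElliptic_quadraticTwist (Int.cast_ne_zero.mpr hd : (d : ℚ) ≠ 0)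
  have han : (W.quadraticTwist (d : ℚ)).analyticRank ≤ 1 := by
    rcases Nat.le_one_iff_eq_zero_or_eq_one.mp hle with h | h
    · rw [h0 d hd h]; exact zero_le_one
    · rw [h1 d hd h]
  obtain ⟨hrk, hsha⟩ := hGZK (W.quadraticTwist (d : ℚ)) han
  exact ⟨hrk.symm, hsha⟩

/-- The rank-zero `2`-converse holds throughout the quadratic twist family of a CM curve —
Burungale–Tian, Ann. of Math. 203 (2026), Thm. 1.1 at `p = 2`, applied to `E^d`, which is CM
(`hasCM_quadraticTwist_of_hasCM`). [cite: BurungaleTian2026, Thm. 1.1 and §3.2.1] -/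
theorem analyticRank_quadraticTwist_eq_zero_of_selmerCorank_eq_zero_of_hasCM
    (hBT : burungaleTian_analyticRank_eq_zero_of_selmerCorank_eq_zero_of_hasCM) (hCM : W.HasCM) :
    ∀ d : ℤ, d ≠ 0 → (W.quadraticTwist d).selmerCorank 2 = 0 →
      (W.quadraticTwist d).analyticRank = 0 := by
  intro d hd h
  have hd' : (d : ℚ) ≠ 0 := Int.cast_ne_zero.mpr hd
  haveI := W.isElliptic_quadraticTwist hd'
  haveI : Fact (Nat.Prime 2) := ⟨Nat.prime_two⟩
  exact hBT _ (hasCM_quadraticTwist_of_hasCM W hCM hd') 2 h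

/-- **Smith's `1/2, 1/2, 0` distribution from the REFEREED theorem** — A. Smith, J. Amer. Math.
Soc. 39 (2026), Thm. 1.2 (`h22 : smith2022_selmerCorank_distribution`) — for every elliptic `W`
satisfying its Assumption 1.1 (`smi22aAssumption W`); the change of normalisation from the printed
`0 < |d| ≤ H` count to densities over squarefree `d` is the tree's
`smith_selmerCorank_density_of_smi22a_printed`. [cite: Smith2026SelmerTwistI, Thm. 1.2 with Assumption 1.1] -/
theorem smith_selmerCorank_density_of_smith2022 (h22 : smith2022_selmerCorank_distribution)
    (hA : smi22aAssumption W) : smith_selmerCorank_density W :=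
  smith_selmerCorank_density_of_smi22a_printed (fun A _ hA ↦ h22 A hA) W hA

end Engine

/-! ### 2. `j = 1728`: Kříž, v5 Thm. 10.17 (1) -/

section J1728

variable (W : WeierstrassCurve ℚ) [W.IsElliptic]

/-- `j = 1728` is the `j`-invariant of CM by the maximal order `ℤ[i]` of `ℚ(i)`
(`maximalCMJInvariants`; Silverman, *Advanced Topics*, App. A §3). [folklore] -/
private theorem j_mem_maximalCMJInvariants_of_j_eq (hj : W.j = 1728) : W.j ∈ maximalCMJInvariants := by
  rw [hj]; simp [maximalCMJInvariants]

/-- A curve over `ℚ` with `j = 1728` has complex multiplication (by `ℤ[i]`: Silverman, *AEC*,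
App. C §11, Example C.11.3.1, the table of the thirteen CM `j`-invariants; in the tree through
`hasCM_of_j_mem_maximalCMJInvariants_holds`). [cite: SilvermanAEC2009, App. C §11 (C.11.3.1)] -/
theorem hasCM_of_j_eq_1728 (hj : W.j = 1728) : W.HasCM :=
  hasCM_of_j_mem_maximalCMJInvariants_holds W (j_mem_maximalCMJInvariants_of_j_eq W hj)

/-- For `j = 1728` the CM field is `K = ℚ(i)`, `d_K = −4`, and `p = 2` is RAMIFIED in `K`
(`Rank1Residual.CMRamified W 2 : 2 ∣ d_K`, `cmFieldDiscrOfJ 1728 = −4`; Cox, Prop. 5.16). [folklore] -/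
private theorem cmRamified_two_of_j_eq_1728 (hj : W.j = 1728) : Rank1Residual.CMRamified W 2 := by
  show ((2 : ℕ) : ℤ) ∣ Rank1Residual.cmFieldDiscrOfJ W.j
  rw [hj]
  norm_num [Rank1Residual.cmFieldDiscrOfJ]

/-- **Kříž's Thm. 10.13 at `p = 2`, `K = ℚ(i)`, as a conditional theorem**: for an elliptic `W/ℚ`
with `j = 1728`, `corank_{ℤ_2} Sel_{2^∞}(W/ℚ) = 1 ⟹ ord_{s=1} L(W, s) = 1`, granted the named
hypothesis `hKg` (UNREFEREED claim). [cite: Kriz2020, Thm. 10.13 (v5) at p = 2, K = ℚ(i)] -/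
theorem analyticRank_eq_one_of_selmerCorank_two_eq_one_of_j_eq_1728
    (hKg : kriz_analyticRank_eq_one_of_selmerCorank_eq_one_of_cmRamified) (hj : W.j = 1728)
    (h1 : W.selmerCorank 2 = 1) : W.analyticRank = 1 := by
  haveI : Fact (Nat.Prime 2) := ⟨Nat.prime_two⟩
  exact hKg W (j_mem_maximalCMJInvariants_of_j_eq W hj) 2 (cmRamified_two_of_j_eq_1728 W hj) h1

/-- The rank-one `2`-converse throughout the twist family of a `j = 1728` curve, from `hKg`:
`j(E^d) = j(E) = 1728` (`j_quadraticTwist`). [cite: Kriz2020, Thm. 10.13 (v5) at p = 2, applied to E^d as in the proof of Thm. 10.17] -/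
theorem analyticRank_quadraticTwist_eq_one_of_selmerCorank_eq_one_of_j_eq_1728
    (hKg : kriz_analyticRank_eq_one_of_selmerCorank_eq_one_of_cmRamified) (hj : W.j = 1728) :
    ∀ d : ℤ, d ≠ 0 → (W.quadraticTwist d).selmerCorank 2 = 1 →
      (W.quadraticTwist d).analyticRank = 1 := by
  intro d hd h1
  have hd' : (d : ℚ) ≠ 0 := Int.cast_ne_zero.mpr hd
  haveI := W.isElliptic_quadraticTwist hd'
  exact analyticRank_eq_one_of_selmerCorank_two_eq_one_of_j_eq_1728 _ hKg
    (by rw [W.j_quadraticTwist hd', hj]) h1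

/-- **Kříž, v5 Thm. 10.17 (1), Goldfeld clause, for every elliptic curve with `j = 1728`, as a
conditional theorem** (neutral Selmer input `hS`). Among the squarefree `d` ordered by `|d|`:
`ord_{s=1} L(E^d, s) = 0` for density `1/2`, `= 1` for density `1/2`, `= r` for density `0`
(`r ≥ 2`) — Conjecture 10.16 for `E` (and more: the `r ≥ 2` clause). Hypotheses: Burungale–Tian
(`hBT`, refereed), KŘÍŽ (`hKg`, unrefereed, used at `p = 2` only), Smith's distribution for `W`
(`hS`). [cite: Kriz2020, Thm. 10.17 (1) with Conj. 10.16 (v5)] [cite: BurungaleTian2026, Thm. 1.1] -/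
theorem goldfeld_of_j_eq_1728_of_converse
    (hBT : burungaleTian_analyticRank_eq_zero_of_selmerCorank_eq_zero_of_hasCM)
    (hKg : kriz_analyticRank_eq_one_of_selmerCorank_eq_one_of_cmRamified) (hj : W.j = 1728)
    (hS : smith_selmerCorank_density W) :
    twistDensity (fun d ↦ d ≠ 0 ∧ (W.quadraticTwist d).analyticRank = 0) (1 / 2) ∧
      twistDensity (fun d ↦ d ≠ 0 ∧ (W.quadraticTwist d).analyticRank = 1) (1 / 2) ∧
        ∀ r : ℕ, 2 ≤ r →
          twistDensity (fun d ↦ d ≠ 0 ∧ (W.quadraticTwist d).analyticRank = r) 0 :=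
  twistDensity_analyticRank_of_twoConverses W
    (analyticRank_quadraticTwist_eq_zero_of_selmerCorank_eq_zero_of_hasCM W hBT
      (hasCM_of_j_eq_1728 W hj))
    (analyticRank_quadraticTwist_eq_one_of_selmerCorank_eq_one_of_j_eq_1728 W hKg hj) hS

/-- The same in Goldfeld's printed normalisation (`lim #{0 < |d| ≤ H : r_an(E^d) = r} / 2H`).
[cite: Kriz2020, Thm. 10.17 (1) (v5)] [cite: SmithGoldfeld2025, §1 (display)] -/
theorem goldfeld_printed_of_j_eq_1728_of_converse
    (hBT : burungaleTian_analyticRank_eq_zero_of_selmerCorank_eq_zero_of_hasCM)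
    (hKg : kriz_analyticRank_eq_one_of_selmerCorank_eq_one_of_cmRamified) (hj : W.j = 1728)
    (hS : smith_selmerCorank_density W) (r : ℕ) :
    Tendsto (fun H : ℕ ↦ (Nat.card {d : ℤ | d ≠ 0 ∧ |d| ≤ (H : ℤ) ∧
        (W.quadraticTwist d).analyticRank = r} : ℝ) / (2 * H)) atTop
      (𝓝 (if r ≤ 1 then 1 / 2 else 0)) :=
  (goldfeld_printed_iff_twistDensity W).2 (goldfeld_of_j_eq_1728_of_converse W hBT hKg hj hS) r

/-- **Kříž, v5 Thm. 10.17 (1), `Ш` clause, with the BSD rank formula, for every elliptic curve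
with `j = 1728`, as a conditional theorem**: `ord_{s=1} L(E^d, s) = rank_ℤ E^d(ℚ)` and
`#Ш(E^d/ℚ) < ∞` for a density-one set of squarefree `d`. Hypotheses `hBT`, `hKg` (the unrefereed
one), `hGZK`, `hS`. [cite: Kriz2020, Thm. 10.17 (1) (v5), "#Ш(E^d) < ∞ for 100% of squarefree d"] -/
theorem bsdRankFormula_finite_sha_densityOne_of_j_eq_1728_of_converse
    (hBT : burungaleTian_analyticRank_eq_zero_of_selmerCorank_eq_zero_of_hasCM)
    (hKg : kriz_analyticRank_eq_one_of_selmerCorank_eq_one_of_cmRamified)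
    (hGZK : rank_eq_analyticRank_of_analyticRank_le_one) (hj : W.j = 1728)
    (hS : smith_selmerCorank_density W) :
    twistDensity (fun d ↦ d ≠ 0 →
      (W.quadraticTwist d).BSDRankFormula ∧ Finite (W.quadraticTwist (d : ℚ)).sha) 1 :=
  twistDensity_bsdRankFormula_finite_sha_of_twoConverses W
    (analyticRank_quadraticTwist_eq_zero_of_selmerCorank_eq_zero_of_hasCM W hBT
      (hasCM_of_j_eq_1728 W hj))
    (analyticRank_quadraticTwist_eq_one_of_selmerCorank_eq_one_of_j_eq_1728 W hKg hj) hGZK hS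

/-- **Goldfeld for `j = 1728` on the refereed route**: as `goldfeld_of_j_eq_1728_of_converse`
with the Selmer input taken from A. Smith, J. Amer. Math. Soc. 39 (2026), Thm. 1.2 (`h22`) under
its Assumption 1.1 for `W` (`hA`); here `hKg` is the only unrefereed binder.
[cite: Kriz2020, Thm. 10.17 (1) (v5)] [cite: Smith2026SelmerTwistI, Thm. 1.2] [cite: BurungaleTian2026, Thm. 1.1] -/
theorem goldfeld_of_j_eq_1728_of_converse_of_smith2022
    (hBT : burungaleTian_analyticRank_eq_zero_of_selmerCorank_eq_zero_of_hasCM)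
    (hKg : kriz_analyticRank_eq_one_of_selmerCorank_eq_one_of_cmRamified)
    (h22 : smith2022_selmerCorank_distribution) (hj : W.j = 1728) (hA : smi22aAssumption W) :
    twistDensity (fun d ↦ d ≠ 0 ∧ (W.quadraticTwist d).analyticRank = 0) (1 / 2) ∧
      twistDensity (fun d ↦ d ≠ 0 ∧ (W.quadraticTwist d).analyticRank = 1) (1 / 2) ∧
        ∀ r : ℕ, 2 ≤ r →
          twistDensity (fun d ↦ d ≠ 0 ∧ (W.quadraticTwist d).analyticRank = r) 0 :=
  goldfeld_of_j_eq_1728_of_converse W hBT hKg hj (smith_selmerCorank_density_of_smith2022 W h22 hA)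

/-- **BSD rank formula and finite `Ш` for `100 %` of the twists, `j = 1728`, refereed route**
(`h22` + `hA` for the Selmer input; `hKg` the only unrefereed binder).
[cite: Kriz2020, Thm. 10.17 (1) (v5)] [cite: Smith2026SelmerTwistI, Thm. 1.2] -/
theorem bsdRankFormula_finite_sha_densityOne_of_j_eq_1728_of_converse_of_smith2022
    (hBT : burungaleTian_analyticRank_eq_zero_of_selmerCorank_eq_zero_of_hasCM)
    (hKg : kriz_analyticRank_eq_one_of_selmerCorank_eq_one_of_cmRamified)
    (hGZK : rank_eq_analyticRank_of_analyticRank_le_one)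
    (h22 : smith2022_selmerCorank_distribution) (hj : W.j = 1728) (hA : smi22aAssumption W) :
    twistDensity (fun d ↦ d ≠ 0 →
      (W.quadraticTwist d).BSDRankFormula ∧ Finite (W.quadraticTwist (d : ℚ)).sha) 1 :=
  bsdRankFormula_finite_sha_densityOne_of_j_eq_1728_of_converse W hBT hKg hGZK hj
    (smith_selmerCorank_density_of_smith2022 W h22 hA)

/-- **Kříž, arXiv:2002.04767v5, Theorem 10.17 (1), with its printed hypotheses, as a conditional
theorem.** Let `E/ℚ` be an elliptic curve with `E(ℚ)[2] ≅ (ℤ/2)²` (`ratTwoTorsionCard W = 4`), no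
cyclic `4`-isogeny defined over `ℚ` (`h4`, in the tree's `Isogeny` vocabulary, as in
`smi22aAssumption`, branch (3)), and CM by `ℚ(i)` (`j = 1728`; the printed alternative `ℚ(√−2)`
is vacuous, see the module docstring). Then, GRANTED Kříž's rank-one `2`-converse (`hKg`, the
ONE unrefereed input), Burungale–Tian (`hBT`), Gross–Zagier–Kolyvagin (`hGZK`) and A. Smith,
J. Amer. Math. Soc. 39 (2026), Thm. 1.2 (`h22`) — all refereed —: (a) Goldfeld's conjecture holds
for `E` (printed normalisation, every `r`), and (b) `ord_{s=1} L(E^d, s) = rank E^d(ℚ)` and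
`#Ш(E^d) < ∞` for `100 %` of squarefree `d`. [cite: Kriz2020, Thm. 10.17 (1) (v5, SP_v5.tex l. 11009-11025)]
[cite: Smith2026SelmerTwistI, Thm. 1.2 with Assumption 1.1 (3)] [cite: BurungaleTian2026, Thm. 1.1] -/
theorem kriz_thm_10_17_1_of_converse_of_smith2022
    (hBT : burungaleTian_analyticRank_eq_zero_of_selmerCorank_eq_zero_of_hasCM)
    (hKg : kriz_analyticRank_eq_one_of_selmerCorank_eq_one_of_cmRamified)
    (hGZK : rank_eq_analyticRank_of_analyticRank_le_one)
    (h22 : smith2022_selmerCorank_distribution) (hj : W.j = 1728) (h2 : ratTwoTorsionCard W = 4)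
    (h4 : ∀ (W'' : WeierstrassCurve ℚ) [W''.IsElliptic] (ψ : Isogeny W W''),
      ψ.IsCyclic → ψ.degree ≠ 4) :
    (∀ r : ℕ, Tendsto (fun H : ℕ ↦ (Nat.card {d : ℤ | d ≠ 0 ∧ |d| ≤ (H : ℤ) ∧
        (W.quadraticTwist d).analyticRank = r} : ℝ) / (2 * H)) atTop
          (𝓝 (if r ≤ 1 then 1 / 2 else 0))) ∧
      twistDensity (fun d ↦ d ≠ 0 →
        (W.quadraticTwist d).BSDRankFormula ∧ Finite (W.quadraticTwist (d : ℚ)).sha) 1 := by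
  have hA : smi22aAssumption W := Or.inr (Or.inr ⟨h2, h4⟩)
  have hS := smith_selmerCorank_density_of_smith2022 W h22 hA
  exact ⟨goldfeld_printed_of_j_eq_1728_of_converse W hBT hKg hj hS,
    bsdRankFormula_finite_sha_densityOne_of_j_eq_1728_of_converse W hBT hKg hGZK hj hS⟩

end J1728

/-! ### 3. Every congruent number curve `E_n : y² = x³ − n²x`, with THE cell hypothesis `hK` -/

section CongruentNumber

/-- **`E_n^{(d)} = E_{n|d|}` as Weierstrass models**: the quadratic twist of `y² = x³ − n²x` by an
integer `d` is `y² = x³ − (n|d|)²x` — Kříž's `E^d : y² = x³ + a d² x + b d³` (v5 §10.3, SP_v5.tex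
l. 10998–11001) with `a = −n²`, `b = 0`, which is the tree's `quadraticTwist` (`a₄ ↦ d² a₄`,
`a₆ ↦ d³ a₆` on short models). [cite: Kriz2020, §10.3 (v5), definition of the quadratic twist E^d (SP_v5.tex l. 10998-11001)] -/
theorem quadraticTwist_congruentNumberCurve (n : ℕ) (d : ℤ) :
    (congruentNumberCurve n).quadraticTwist (d : ℚ) = congruentNumberCurve (n * d.natAbs) := by
  have hd : ((d.natAbs : ℕ) : ℚ) ^ 2 = (d : ℚ) ^ 2 := by
    rw [Nat.cast_natAbs, Int.cast_abs, sq_abs]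
  ext
  · rfl
  · simp [quadraticTwist, congruentNumberCurve, WeierstrassCurve.b₂]
  · rfl
  · simp only [quadraticTwist, congruentNumberCurve, WeierstrassCurve.b₄, Nat.cast_mul, mul_pow]
    rw [hd]; ring
  · simp [quadraticTwist, congruentNumberCurve, WeierstrassCurve.b₆]

/-- The rank-one `2`-converse throughout the twist family of `E_n` (`n ≠ 0`) IS the cell's named
hypothesis `hK : rankOne_twoConverse_congruentNumber` (at `E_{n|d|}`).
[cite: Kriz2020, Thm. 10.17 (2) (v5)] -/
theorem analyticRank_quadraticTwist_congruentNumberCurve_eq_one_of_converse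
    (hK : rankOne_twoConverse_congruentNumber) {n : ℕ} (hn : n ≠ 0) :
    ∀ d : ℤ, d ≠ 0 → ((congruentNumberCurve n).quadraticTwist d).selmerCorank 2 = 1 →
      ((congruentNumberCurve n).quadraticTwist d).analyticRank = 1 := by
  intro d hd
  rw [quadraticTwist_congruentNumberCurve]
  exact hK (Nat.mul_ne_zero hn (Int.natAbs_ne_zero.mpr hd))

/-- The rank-zero `2`-converse throughout the twist family of `E_n` (`n ≠ 0`) is Burungale–Tian's
theorem (`E_n` has `j = 1728`, CM by `ℤ[i]`). [cite: BurungaleTian2026, Thm. 1.1] -/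
theorem analyticRank_quadraticTwist_congruentNumberCurve_eq_zero_of_burungaleTian
    (hBT : burungaleTian_analyticRank_eq_zero_of_selmerCorank_eq_zero_of_hasCM) {n : ℕ}
    (hn : n ≠ 0) :
    ∀ d : ℤ, d ≠ 0 → ((congruentNumberCurve n).quadraticTwist d).selmerCorank 2 = 0 →
      ((congruentNumberCurve n).quadraticTwist d).analyticRank = 0 := by
  haveI := isElliptic_congruentNumberCurve hn
  exact analyticRank_quadraticTwist_eq_zero_of_selmerCorank_eq_zero_of_hasCM _ hBT
    (hasCM_of_j_mem_maximalCMJInvariants_holds _ (congruentNumberCurve_j_mem_maximalCMJInvariants n))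

/-- **Goldfeld's conjecture for EVERY congruent number curve `E_n : y² = x³ − n²x` (`n ≠ 0`),
in full, conditionally** (Kříž, v5 Thm. 10.17 (1)/(3): `E_n` has `E_n(ℚ)[2] ≅ (ℤ/2)²`, no cyclic
`4`-isogeny, CM by `ℤ[i]`): among the squarefree `d`, `ord_{s=1} L(E_n^{(d)}, s) = 0` with
density `1/2`, `= 1` with density `1/2`, `= r ≥ 2` with density `0`. Hypotheses: Burungale–Tian
(`hBT`), THE cell hypothesis `hK : rankOne_twoConverse_congruentNumber` (Kříž; the only
unrefereed input), and Smith's distribution for `E_n` (`hS`, neutral: discharged by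
arXiv:2503.17619 Thm. 1.1, or on the REFEREED route by
`smith_selmerCorank_density_congruentNumberCurve_of_smith2022 h22 hn` of
`Kriz2020/CongruentNumberDensityOneProofs.lean`, J. Amer. Math. Soc. 39 (2026) Thm. 1.2 with
Assumption 1.1 (3) proved for `E_n`). The sibling file's `goldfeld_congruentNumberCurve_of_converse`
is the case `n = 1`, first two clauses. [cite: Kriz2020, Thm. 10.17 (1), (3) (v5)]
[cite: BurungaleTian2026, Thm. 1.1] -/
theorem goldfeld_congruentNumberCurve_twistFamily_of_converse
    (hBT : burungaleTian_analyticRank_eq_zero_of_selmerCorank_eq_zero_of_hasCM)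
    (hK : rankOne_twoConverse_congruentNumber) {n : ℕ} (hn : n ≠ 0)
    (hS : smith_selmerCorank_density (congruentNumberCurve n)) :
    twistDensity
        (fun d ↦ d ≠ 0 ∧ ((congruentNumberCurve n).quadraticTwist d).analyticRank = 0) (1 / 2) ∧
      twistDensity
        (fun d ↦ d ≠ 0 ∧ ((congruentNumberCurve n).quadraticTwist d).analyticRank = 1) (1 / 2) ∧
        ∀ r : ℕ, 2 ≤ r →
          twistDensity
            (fun d ↦ d ≠ 0 ∧ ((congruentNumberCurve n).quadraticTwist d).analyticRank = r) 0 := by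
  haveI := isElliptic_congruentNumberCurve hn
  exact twistDensity_analyticRank_of_twoConverses _
    (analyticRank_quadraticTwist_congruentNumberCurve_eq_zero_of_burungaleTian hBT hn)
    (analyticRank_quadraticTwist_congruentNumberCurve_eq_one_of_converse hK hn) hS

/-- **Goldfeld for `E_n`, printed normalisation** (`lim #{0 < |d| ≤ H : r_an(E_n^{(d)}) = r} / 2H
= 1/2, 1/2, 0, …`), conditionally on `hBT`, `hK`, `hS` as above.
[cite: Kriz2020, Conj. 10.16 and Thm. 10.17 (3) (v5), "Goldfeld's conjecture is true for the congruent number family"] -/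
theorem goldfeld_printed_congruentNumberCurve_of_converse
    (hBT : burungaleTian_analyticRank_eq_zero_of_selmerCorank_eq_zero_of_hasCM)
    (hK : rankOne_twoConverse_congruentNumber) {n : ℕ} (hn : n ≠ 0)
    (hS : smith_selmerCorank_density (congruentNumberCurve n)) (r : ℕ) :
    Tendsto (fun H : ℕ ↦ (Nat.card {d : ℤ | d ≠ 0 ∧ |d| ≤ (H : ℤ) ∧
        ((congruentNumberCurve n).quadraticTwist d).analyticRank = r} : ℝ) / (2 * H)) atTop
      (𝓝 (if r ≤ 1 then 1 / 2 else 0)) := by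
  haveI := isElliptic_congruentNumberCurve hn
  exact (goldfeld_printed_iff_twistDensity _).2
    (goldfeld_congruentNumberCurve_twistFamily_of_converse hBT hK hn hS) r

/-- **The BSD rank formula AND `#Ш < ∞` for `100 %` of the quadratic twists of `E_n`
(`n ≠ 0`), conditionally** (Kříž, v5 Thm. 10.17 (1)–(2), `Ш` clauses): the squarefree `d` with
`ord_{s=1} L(E_{n|d|}, s) = rank_ℤ E_{n|d|}(ℚ)` and `Ш(E_{n|d|}/ℚ)` finite have density `1`.
Hypotheses: `hBT`, `hK` (the only unrefereed input), `hGZK`, `hS` (neutral, see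
`goldfeld_congruentNumberCurve_twistFamily_of_converse`). For `n = 1` this refines the cell's
consumer `bsdRank_densityOne_congruentNumber_of_converse` by the `Ш` clause.
[cite: Kriz2020, Thm. 10.17 (1)-(2) (v5)] [cite: KolyvaginEulerSystems1990] -/
theorem bsdRankFormula_finite_sha_densityOne_congruentNumberCurve_of_converse
    (hBT : burungaleTian_analyticRank_eq_zero_of_selmerCorank_eq_zero_of_hasCM)
    (hK : rankOne_twoConverse_congruentNumber)
    (hGZK : rank_eq_analyticRank_of_analyticRank_le_one) {n : ℕ} (hn : n ≠ 0)
    (hS : smith_selmerCorank_density (congruentNumberCurve n)) :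
    twistDensity (fun d ↦ d ≠ 0 →
      ((congruentNumberCurve n).quadraticTwist d).BSDRankFormula ∧
        Finite ((congruentNumberCurve n).quadraticTwist (d : ℚ)).sha) 1 := by
  haveI := isElliptic_congruentNumberCurve hn
  exact twistDensity_bsdRankFormula_finite_sha_of_twoConverses _
    (analyticRank_quadraticTwist_congruentNumberCurve_eq_zero_of_burungaleTian hBT hn)
    (analyticRank_quadraticTwist_congruentNumberCurve_eq_one_of_converse hK hn) hGZK hS

/-- The same read on the congruent number curves themselves (`E_n^{(d)} = E_{n|d|}`): for a
density-one set of squarefree `d`, `ord_{s=1} L(E_{n|d|}, s) = rank_ℤ E_{n|d|}(ℚ)` and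
`#Ш(E_{n|d|}) < ∞`. [cite: Kriz2020, Thm. 10.17 (2) (v5), display (congruentconclusion)] -/
theorem bsdRankFormula_finite_sha_densityOne_congruentNumberCurve_of_converse'
    (hBT : burungaleTian_analyticRank_eq_zero_of_selmerCorank_eq_zero_of_hasCM)
    (hK : rankOne_twoConverse_congruentNumber)
    (hGZK : rank_eq_analyticRank_of_analyticRank_le_one) {n : ℕ} (hn : n ≠ 0)
    (hS : smith_selmerCorank_density (congruentNumberCurve n)) :
    twistDensity (fun d ↦ (congruentNumberCurve (n * d.natAbs)).BSDRankFormula ∧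
      Finite (congruentNumberCurve (n * d.natAbs)).sha) 1 := by
  refine twistDensity_one_mono (fun d hsq h ↦ ?_)
    (bsdRankFormula_finite_sha_densityOne_congruentNumberCurve_of_converse hBT hK hGZK hn hS)
  have := h hsq.ne_zero
  rwa [quadraticTwist_congruentNumberCurve] at this

/-! #### §3 on the REFEREED Selmer route: `h22` (A. Smith, J. Amer. Math. Soc. 39 (2026), Thm. 1.2)

Smith's Assumption 1.1, branch (3), is PROVED for every `E_n`, `n ≠ 0`
(`smi22aAssumption_congruentNumberCurve`, `Kriz2020/CongruentNumberDensityOneProofs.lean`), so the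
neutral `hS` of the three theorems above is discharged by
`smith_selmerCorank_density_congruentNumberCurve_of_smith2022 h22 hn`. On this route the trust
base of the Goldfeld / `100 %`-BSD statements for the whole congruent number family is: `hK`
(Kříž v5 Thm. 10.13 at `p = 2`, the ONLY unrefereed binder) + `h22` + `hBT` (+ `hGZK` for the `Ш`
clause) — all three refereed. -/

/-- **Goldfeld's conjecture for the family `{E_{n|d|}}_d` of every `E_n`, refereed Selmer route**:
twin of `goldfeld_congruentNumberCurve_twistFamily_of_converse` with `hS` discharged by A. Smith,
J. Amer. Math. Soc. 39 (2026), Thm. 1.2 (`h22`); `hK` is the only unrefereed binder.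
[cite: Kriz2020, Thm. 10.17 (1), (3) (v5)] [cite: Smith2026SelmerTwistI, Thm. 1.2 with Assumption 1.1 (3)]
[cite: BurungaleTian2026, Thm. 1.1] -/
theorem goldfeld_congruentNumberCurve_twistFamily_of_converse_of_smith2022
    (hBT : burungaleTian_analyticRank_eq_zero_of_selmerCorank_eq_zero_of_hasCM)
    (hK : rankOne_twoConverse_congruentNumber) (h22 : smith2022_selmerCorank_distribution)
    {n : ℕ} (hn : n ≠ 0) :
    twistDensity
        (fun d ↦ d ≠ 0 ∧ ((congruentNumberCurve n).quadraticTwist d).analyticRank = 0) (1 / 2) ∧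
      twistDensity
        (fun d ↦ d ≠ 0 ∧ ((congruentNumberCurve n).quadraticTwist d).analyticRank = 1) (1 / 2) ∧
        ∀ r : ℕ, 2 ≤ r →
          twistDensity
            (fun d ↦ d ≠ 0 ∧ ((congruentNumberCurve n).quadraticTwist d).analyticRank = r) 0 :=
  goldfeld_congruentNumberCurve_twistFamily_of_converse hBT hK hn
    (smith_selmerCorank_density_congruentNumberCurve_of_smith2022 h22 hn)

/-- **Goldfeld for `E_n`, printed normalisation, refereed Selmer route** (`h22` for `hS`).
[cite: Kriz2020, Conj. 10.16 and Thm. 10.17 (3) (v5)] [cite: Smith2026SelmerTwistI, Thm. 1.2] -/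
theorem goldfeld_printed_congruentNumberCurve_of_converse_of_smith2022
    (hBT : burungaleTian_analyticRank_eq_zero_of_selmerCorank_eq_zero_of_hasCM)
    (hK : rankOne_twoConverse_congruentNumber) (h22 : smith2022_selmerCorank_distribution)
    {n : ℕ} (hn : n ≠ 0) (r : ℕ) :
    Tendsto (fun H : ℕ ↦ (Nat.card {d : ℤ | d ≠ 0 ∧ |d| ≤ (H : ℤ) ∧
        ((congruentNumberCurve n).quadraticTwist d).analyticRank = r} : ℝ) / (2 * H)) atTop
      (𝓝 (if r ≤ 1 then 1 / 2 else 0)) :=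
  goldfeld_printed_congruentNumberCurve_of_converse hBT hK hn
    (smith_selmerCorank_density_congruentNumberCurve_of_smith2022 h22 hn) r

/-- **The BSD rank formula AND `#Ш < ∞` for `100 %` of the quadratic twists of every `E_n`,
refereed Selmer route** (`h22` for `hS`; `hK` the only unrefereed binder; `hGZK` for `Ш`).
[cite: Kriz2020, Thm. 10.17 (1)-(2) (v5)] [cite: Smith2026SelmerTwistI, Thm. 1.2] [cite: KolyvaginEulerSystems1990] -/
theorem bsdRankFormula_finite_sha_densityOne_congruentNumberCurve_of_converse_of_smith2022
    (hBT : burungaleTian_analyticRank_eq_zero_of_selmerCorank_eq_zero_of_hasCM)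
    (hK : rankOne_twoConverse_congruentNumber)
    (hGZK : rank_eq_analyticRank_of_analyticRank_le_one) (h22 : smith2022_selmerCorank_distribution)
    {n : ℕ} (hn : n ≠ 0) :
    twistDensity (fun d ↦ d ≠ 0 →
      ((congruentNumberCurve n).quadraticTwist d).BSDRankFormula ∧
        Finite ((congruentNumberCurve n).quadraticTwist (d : ℚ)).sha) 1 :=
  bsdRankFormula_finite_sha_densityOne_congruentNumberCurve_of_converse hBT hK hGZK hn
    (smith_selmerCorank_density_congruentNumberCurve_of_smith2022 h22 hn)

/-- The same read on the curves `E_{n|d|}` themselves, refereed Selmer route: for a density-one set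
of squarefree `d`, `ord_{s=1} L(E_{n|d|}, s) = rank_ℤ E_{n|d|}(ℚ)` and `#Ш(E_{n|d|}) < ∞`.
[cite: Kriz2020, Thm. 10.17 (2) (v5), display (congruentconclusion)] [cite: Smith2026SelmerTwistI, Thm. 1.2] -/
theorem bsdRankFormula_finite_sha_densityOne_congruentNumberCurve_of_converse_of_smith2022'
    (hBT : burungaleTian_analyticRank_eq_zero_of_selmerCorank_eq_zero_of_hasCM)
    (hK : rankOne_twoConverse_congruentNumber)
    (hGZK : rank_eq_analyticRank_of_analyticRank_le_one) (h22 : smith2022_selmerCorank_distribution)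
    {n : ℕ} (hn : n ≠ 0) :
    twistDensity (fun d ↦ (congruentNumberCurve (n * d.natAbs)).BSDRankFormula ∧
      Finite (congruentNumberCurve (n * d.natAbs)).sha) 1 :=
  bsdRankFormula_finite_sha_densityOne_congruentNumberCurve_of_converse' hBT hK hGZK hn
    (smith_selmerCorank_density_congruentNumberCurve_of_smith2022 h22 hn)

end CongruentNumber

end Literature.NumberTheory.EllipticCurves

end
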